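import Literature.AlgebraicGeometry.Motives.UnitaryPeriodDomainBallModel
import Literature.AlgebraicGeometry.Motives.UnitaryPeriodDomainCompactFixedPoint
import Literature.AlgebraicGeometry.HodgeTheory.SpecialCycleSupport
import HarnessLib

/-!
# `I_{n,1}` and `SU(n, 1)` in the affine chart `z₀ = 1` of the ball `B(L) ⊂ ℙ(ℂ^{1,n})`: the Möbius deck relation of
# route `EisensteinMiddleThird` is the orbit relation of `SU(n, 1) ↷ I_{n,1}` (Allcock–Freitag §3 (3.1); BMM §1.1)

Layer `Literature/AlgebraicGeometry/Motives`, namespace `Literature.AlgebraicGeometry.Motives`; lane `lit-hodgefound`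
(Track 2 foundations library), Layer A (prover seat p13, generation 11, row g11-#3 «the chart `z₀ = 1`: `SU(n,1)` = the
determinant-one deck matrices, `I_{n,1}` = the chart ball, deck relation = orbit relation»). A JUNCTION, consumed BY
NAME and not restated, of

* the lane's Layer A: `unitaryPeriodDomain n 1 = I_{n,1}`, `stdSpecialUnitaryGroup n 1 = SU(n, 1)`, `stdMat`, `sigMatrix`,
  `ofStdMat` (`Motives/UnitaryPeriodDomainPolarDecomposition`), the Riesz-vector homeomorphism
  `ballHomeomorph : I_{n,1} ≃ₜ Metric.ball (0 : EuclideanSpace ℂ (Fin n)) 1` and the fractional-linear formula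
  `ballVector_smul` (`Motives/UnitaryPeriodDomainBallModel`), É. Cartan's fixed-point theorem
  `exists_smul_eq_of_isOfFinOrder` (`Motives/UnitaryPeriodDomainCompactFixedPoint`);
* the chart of `AlgebraicGeometry/HodgeTheory/SpecialCycleSupport` (definition request of route
  `HodgeConjecture/EisensteinMiddleThird`): `ballGram n = J = diag(1, -1, …, -1)`, `ballLift z = ẑ = (1, z₁, …, zₙ)`,
  `smul_ballLift_eq_mulVec_iff` (the route's verbatim deck clause
  `wᵢ (γ₀₀ + Σⱼ γ₀,ⱼ₊₁ zⱼ) = γᵢ₊₁,₀ + Σⱼ γᵢ₊₁,ⱼ₊₁ zⱼ` ⟺ `(γ ẑ)₀ • ŵ = γ ẑ`), `ballGram_four` (the route's literal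
  `Matrix.diagonal ![1, -1, -1, -1, -1]`).

Everything is PROVED; the three definitions (`chartIdx`, `chartMatrix`, `chartMatrixHom`) are explicit; no named fact,
net debt 0.

## Sources, verbatim

D. Allcock, E. Freitag, *Cubic surfaces and Borcherds products*, Comment. Math. Helv. 77 (2002), held copy
`paper:doi-10-1007-s00014-002-8340-4`: (2.1) p0002 L30 "`⟨a, b⟩ = ā₀b₀ − ā₁b₁ − ⋯ − ā₄b₄`"; §3 p0004 L18–L41 "The
group `Γ` acts on a complex 4-ball in the projective space of `ℂ^{1,4} = Λ ⊗_𝓔 ℂ`. […] When `L` is Lorentzian, the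
positive points form an open `n`-ball `B(L)` in projective space […] any element of `B(Λ)` has a unique representative
`z ∈ ℂ^{1,4}` whose `z₀` component is `1`. Considering the remaining coordinates identifies `B(Λ)` with the set of
all `(z₁, …, z₄) ∈ ℂ⁴` satisfying `|z₁|² + ⋯ + |z₄|² < 1`. (3.1)".
N. Bergeron, J. Millson, C. Moeglin (2016), Introduction §1.1 (held `paper:arxiv-1306.1515` p0003 L26): "`X = G/K_∞ =
U(p,q)/(U(p) × U(q))` […] `q = 1` […] Then `X` identifies with the unit ball in `ℂᵖ`."
J.-P. Serre, *Matrices* (GTM 216), §10.3: "`U(p,q) = {M | M*JM = J}`" (through `Motives/UnitaryPeriodDomainPolarDecomposition`).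

## The dictionary

The lane writes `ℂ^{n,1} = ℂⁿ × ℂ¹` with `H₀ = diag(1_n, -1)` and realises `I_{n,1}` as positive `n`-planes / strict
contractions `Z : ℂⁿ → ℂ¹`; the chart writes `ℂ^{1,n}` with `J = diag(1, -1_n)` and realises the ball as POSITIVE
LINES `[1 : z₁ : ⋯ : zₙ]`. The reindexing `chartIdx : Fin n ⊕ Fin 1 ≃ Fin (n + 1)` (`inr 0 ↦ 0`, `inl j ↦ j.succ`)
carries `H₀` to `-J` (`submatrix_sigMatrix_chartIdx`) — orthogonality and unitarity are insensitive to the sign — and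
the NEGATIVE line `(z, e)` of `Z` (`z = Z† e`, `Motives/UnitaryPeriodDomainBallModel`) to the chart's `ẑ`. So
`γ = chartMatrix g` (the reindexed standard-basis matrix of `g ∈ SU(n, 1)`) satisfies `γᴴ J γ = J`, `det γ = 1`, and
`γ ẑ = (γ ẑ)₀ • ŵ` with `w` the chart point of `g • Z` (`chartMatrix_mulVec_ballLift`) — the route's deck clause.

## What is here

* `chartIdx`, `submatrix_sigMatrix_chartIdx` (`H₀ ↦ -J`); **`chartMatrix g`** with `conjTranspose_chartMatrix_mul_ballGram_mul`
  (`γᴴ J γ = J`), `det_chartMatrix` (`= 1`), `chartMatrix_mul` / `chartMatrix_one` / **`chartMatrixHom : SU(n,1) →* M_{n+1}(ℂ)`**,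
  `chartMatrix_injective`, `continuous_chartMatrix`; **`exists_chartMatrix_eq`** (every determinant-one `γ` with
  `γᴴ J γ = J` is a chart matrix), `norm_det_eq_one_of_conjTranspose_mul_ballGram_mul` (`|det γ| = 1`) and
  **`exists_smul_chartMatrix_eq`** (`U(J) = 𝕊¹ · SU(n, 1)`: every `γ` with `γᴴ J γ = J` is `c • chartMatrix g`, `|c| = 1`);
  the route's literal `n = 4` forms `conjTranspose_chartMatrix_mul_diagonal_four`, `exists_smul_chartMatrix_eq_of_diagonal_four`.
* `ballLift_eq_sumElim_comp` (`ẑ` = the lane's `(z, e)` reindexed), `stdMat_mulVec_sumElim` (matrix × coordinates =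
  coordinates of the image), `cblock₂_ballVector_apply_ne_zero` (the Möbius denominator never vanishes on the ball),
  **`chartMatrix_mulVec_ballLift : γ ẑ = (γ ẑ)₀ • ŵ`**, **`deckClause_chart_smul`** (the route's verbatim clause for
  `(z, w) = (chart Z, chart (g • Z))`, `γ = c • chartMatrix g`), `eq_chart_smul_of_deckClause` (the clause determines `w`),
  **`deckClause_iff_smul_eq`** and **`exists_deckClause_iff_exists_smul`**: "`∃ γ ∈ S, w = γ · z`" iff some `g ∈ SU(n,1)`
  with `c • chartMatrix g ∈ S` (`|c| = 1`) moves `ballHomeomorph⁻¹ z` to `ballHomeomorph⁻¹ w` — THE DECK RELATION IS THE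
  ORBIT RELATION.
* `exists_deckClause_self_of_isOfFinOrder` / `not_isOfFinOrder_of_forall_not_deckClause_self`: a deck transformation of
  finite order fixes a point of the chart ball (Cartan); a deck group acting freely is torsion-free.

## Not here

The chart's holomorphic structure and the covering `π` of the route (hypotheses of its items); cusps / Baily–Borel;
the Eisenstein lattice `𝓔^{1,4}` and `Γ(3)`; general signature `(p, q)`, `q ≥ 2` (no chart). The Hodge conjecture is
not addressed.

## References

* [AllcockFreitag2002] D. Allcock, E. Freitag, *Cubic surfaces and Borcherds products*, Comment. Math. Helv. 77 (2002)
  270–296, (2.1), §3 (3.1) (held `paper:doi-10-1007-s00014-002-8340-4` p0002, p0004).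
* [BergeronMillsonMoeglin2016Balls] N. Bergeron, J. Millson, C. Moeglin, Acta Math. 216 (2016), Introduction §1.1.
* [Serre2010] J.-P. Serre, *Matrices*, §10.3 (`U(p,q) = {M | M*JM = J}`), Prop. 10.5.
* [FarmakisMoskowitz2013] I. Farmakis, M. Moskowitz, *Fixed Point Theorems and Their Applications* (2013), Thm. 4.0.1,
  Cor. 4.2.11 (held p0086, p0103).
* [CarlsonMullerStachPeters2017] J. Carlson, S. Müller-Stach, C. Peters, *Period Mappings and Period Domains*, 2nd ed.,
  §17.3 (p0413 L26: the ball as `h(z) < 0` in projective space).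
* [GohbergLancasterRodman2005] I. Gohberg, P. Lancaster, L. Rodman, *Indefinite Linear Algebra and Applications* (2005),
  §10.2 (p0234: block form, invertibility of the Möbius denominator).
-/

noncomputable section

open Module Matrix Topology
open scoped InnerProductSpace ComplexConjugate

namespace Literature.AlgebraicGeometry.Motives

/-! ## §1 The reindexing `H₀ ↦ -J` and the chart matrix of `g ∈ SU(n, 1)` -/

section Chart

open Literature.AlgebraicGeometry.HodgeTheory

variable {n : ℕ}

/-- `e₀ = 1` for the unit vector `e` of `ℂ¹` (file-local copy of the `BallModel` helper). [folklore] -/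
private theorem unitVec_zero : (unitVec : EuclideanSpace ℂ (Fin 1)) 0 = 1 := by
  simp [unitVec]

/-- The reindexing `Fin n ⊕ Fin 1 ≃ Fin (n + 1)` of the chart `z₀ = 1`: the NEGATIVE coordinate `inr 0` of the lane's
`ℂⁿ × ℂ¹` becomes the homogeneous coordinate `0`, the positive coordinates `inl j` become `j.succ` (the chart's
`ẑ = (1, z₁, …, zₙ)`, `ballLift`). [cite: AllcockFreitag2002, (2.1), (3.1)] -/
def chartIdx (n : ℕ) : Fin n ⊕ Fin 1 ≃ Fin (n + 1) where
  toFun := Sum.elim Fin.succ fun _ => 0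
  invFun i := Fin.cases (motive := fun _ => Fin n ⊕ Fin 1) (Sum.inr 0) Sum.inl i
  left_inv s := by
    rcases s with j | k
    · simp only [Sum.elim_inl, Fin.cases_succ]
    · simp only [Sum.elim_inr, Fin.cases_zero, Sum.inr.injEq]
      exact (Fin.fin_one_eq_zero k).symm
  right_inv i := by
    refine Fin.cases ?_ (fun j => ?_) i
    · simp only [Fin.cases_zero, Sum.elim_inr]
    · simp only [Fin.cases_succ, Sum.elim_inl]

/-- `chartIdx (inl j) = j.succ`. [cite: AllcockFreitag2002, (3.1)] -/
@[simp] theorem chartIdx_inl (j : Fin n) : chartIdx n (Sum.inl j) = j.succ := rfl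

/-- `chartIdx (inr k) = 0`. [cite: AllcockFreitag2002, (3.1)] -/
@[simp] theorem chartIdx_inr (k : Fin 1) : chartIdx n (Sum.inr k) = 0 := rfl

/-- `chartIdx⁻¹ 0 = inr 0`. [cite: AllcockFreitag2002, (3.1)] -/
@[simp] theorem chartIdx_symm_zero : (chartIdx n).symm 0 = Sum.inr 0 := rfl

/-- `chartIdx⁻¹ j.succ = inl j`. [cite: AllcockFreitag2002, (3.1)] -/
@[simp] theorem chartIdx_symm_succ (j : Fin n) : (chartIdx n).symm j.succ = Sum.inl j := by
  simp only [chartIdx, Equiv.coe_fn_symm_mk, Fin.cases_succ]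

/-- **The lane's `J = sigMatrix n 1 = diag(1_n, -1)` reindexed to the chart is `-ballGram n = diag(-1, 1, …, 1)`**
(the chart's form `ā₀b₀ - ā₁b₁ - ⋯ - āₙbₙ` is the OPPOSITE of the lane's `H₀`; the ball is its cone of positive
lines). [cite: AllcockFreitag2002, (2.1)] -/
theorem submatrix_sigMatrix_chartIdx :
    (sigMatrix n 1).submatrix (chartIdx n).symm (chartIdx n).symm = -ballGram n := by
  rw [sigMatrix_eq_diagonal, Matrix.submatrix_diagonal_equiv, ballGram, Matrix.diagonal_neg]
  congr 1
  funext i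
  refine Fin.cases ?_ (fun j => ?_) i
  · simp [frameSign]
  · simp [frameSign]

/-- **The chart matrix of `g ∈ SU(n, 1)`**: the matrix of `g` in the standard adapted basis of `ℂⁿ × ℂ¹`, reindexed
by `chartIdx` — an `(n+1) × (n+1)` complex matrix acting on the homogeneous coordinates `ẑ = (1, z₁, …, zₙ)` of the
chart. [cite: AllcockFreitag2002, (2.1), (3.1)] [cite: Serre2010, §10.3 (`U(p,q) = {M | M*JM = J}`)] -/
def chartMatrix (g : stdSpecialUnitaryGroup n 1) : Matrix (Fin (n + 1)) (Fin (n + 1)) ℂ :=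
  (stdMat (g : (EuclideanSpace ℂ (Fin n) × EuclideanSpace ℂ (Fin 1)) ≃ₗ[ℂ]
    (EuclideanSpace ℂ (Fin n) × EuclideanSpace ℂ (Fin 1)))).submatrix (chartIdx n).symm (chartIdx n).symm

/-- Entries of the chart matrix. [cite: AllcockFreitag2002, (3.1)] -/
theorem chartMatrix_apply (g : stdSpecialUnitaryGroup n 1) (a b : Fin (n + 1)) :
    chartMatrix g a b =
      stdMat (g : (EuclideanSpace ℂ (Fin n) × EuclideanSpace ℂ (Fin 1)) ≃ₗ[ℂ]
        (EuclideanSpace ℂ (Fin n) × EuclideanSpace ℂ (Fin 1))) ((chartIdx n).symm a) ((chartIdx n).symm b) :=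
  rfl

/-- **`γᴴ J γ = J`**: the chart matrix of `g ∈ SU(n, 1)` satisfies the route's membership condition for the deck
group (`γᴴ * ballGram n * γ = ballGram n`; for `n = 4`, `ballGram 4 = Matrix.diagonal ![1, -1, -1, -1, -1]` by
`ballGram_four`). [cite: AllcockFreitag2002, (2.1)] [cite: Serre2010, §10.3] -/
theorem conjTranspose_chartMatrix_mul_ballGram_mul (g : stdSpecialUnitaryGroup n 1) :
    (chartMatrix g)ᴴ * ballGram n * chartMatrix g = ballGram n := by
  have h := congrArg (fun M : Matrix (Fin n ⊕ Fin 1) (Fin n ⊕ Fin 1) ℂ =>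
    M.submatrix (chartIdx n).symm (chartIdx n).symm) (conjTranspose_stdMat_mul g)
  rw [← Matrix.submatrix_mul_equiv _ _ _ ((chartIdx n).symm), ← Matrix.submatrix_mul_equiv _ _ _ ((chartIdx n).symm),
    submatrix_sigMatrix_chartIdx, ← Matrix.conjTranspose_submatrix, Matrix.mul_neg, Matrix.neg_mul, neg_inj] at h
  exact h

/-- **`det γ = 1`.** [cite: Serre2010, §10.3] -/
theorem det_chartMatrix (g : stdSpecialUnitaryGroup n 1) : (chartMatrix g).det = 1 := by
  rw [chartMatrix, Matrix.det_submatrix_equiv_self, det_stdMat_eq_one]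

/-- The chart matrix is multiplicative. [cite: Serre2010, §10.3] -/
theorem chartMatrix_mul (g h : stdSpecialUnitaryGroup n 1) : chartMatrix (g * h) = chartMatrix g * chartMatrix h := by
  rw [chartMatrix, chartMatrix, chartMatrix, Matrix.submatrix_mul_equiv, Subgroup.coe_mul, stdMat, AdaptedBasis.mat,
    LinearEquiv.coe_toLinearMap_mul, LinearMap.toMatrix_mul]

/-- The chart matrix of `1` is `1`. [cite: Serre2010, §10.3] -/
theorem chartMatrix_one : chartMatrix (1 : stdSpecialUnitaryGroup n 1) = 1 := by
  rw [chartMatrix, OneMemClass.coe_one, stdMat, AdaptedBasis.mat,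
    show (((1 : (EuclideanSpace ℂ (Fin n) × EuclideanSpace ℂ (Fin 1)) ≃ₗ[ℂ]
      (EuclideanSpace ℂ (Fin n) × EuclideanSpace ℂ (Fin 1)))) :
        (EuclideanSpace ℂ (Fin n) × EuclideanSpace ℂ (Fin 1)) →ₗ[ℂ]
          (EuclideanSpace ℂ (Fin n) × EuclideanSpace ℂ (Fin 1))) = LinearMap.id from rfl,
    LinearMap.toMatrix_id, Matrix.submatrix_one_equiv]

/-- **`SU(n, 1) →* M_{n+1}(ℂ)`, `g ↦` its chart matrix** (a monoid homomorphism; its values are the determinant-one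
matrices with `γᴴ J γ = J`). [cite: Serre2010, §10.3] [cite: AllcockFreitag2002, (2.1)] -/
def chartMatrixHom : stdSpecialUnitaryGroup n 1 →* Matrix (Fin (n + 1)) (Fin (n + 1)) ℂ where
  toFun := chartMatrix
  map_one' := chartMatrix_one
  map_mul' := chartMatrix_mul

/-- `chartMatrixHom g = chartMatrix g`. [cite: Serre2010, §10.3] -/
@[simp] theorem chartMatrixHom_apply (g : stdSpecialUnitaryGroup n 1) : chartMatrixHom g = chartMatrix g := rfl

/-- `g ↦ chartMatrix g` is injective. [cite: Serre2010, §10.3] -/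
theorem chartMatrix_injective : Function.Injective (chartMatrix : stdSpecialUnitaryGroup n 1 → _) := by
  intro g h hgh
  have hm : stdMat (g : (EuclideanSpace ℂ (Fin n) × EuclideanSpace ℂ (Fin 1)) ≃ₗ[ℂ]
        (EuclideanSpace ℂ (Fin n) × EuclideanSpace ℂ (Fin 1))) =
      stdMat (h : (EuclideanSpace ℂ (Fin n) × EuclideanSpace ℂ (Fin 1)) ≃ₗ[ℂ]
        (EuclideanSpace ℂ (Fin n) × EuclideanSpace ℂ (Fin 1))) := by
    have := congrArg (fun M : Matrix (Fin (n + 1)) (Fin (n + 1)) ℂ => M.submatrix (chartIdx n) (chartIdx n)) hgh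
    simpa only [chartMatrix, Matrix.submatrix_submatrix, Equiv.symm_comp_self, Matrix.submatrix_id_id] using this
  exact Subtype.ext (LinearEquiv.toLinearMap_injective ((LinearMap.toMatrix _ _).injective hm))

/-- `g ↦ chartMatrix g` is continuous. [cite: Serre2010, §10.3] -/
theorem continuous_chartMatrix : Continuous (chartMatrix : stdSpecialUnitaryGroup n 1 → _) :=
  continuous_stdMat.matrix_submatrix _ _

/-- **Every determinant-one `γ` with `γᴴ J γ = J` is the chart matrix of a unique `g ∈ SU(n, 1)`.**
[cite: Serre2010, §10.3 Prop. 10.5] [cite: AllcockFreitag2002, (2.1)] -/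
theorem exists_chartMatrix_eq {γ : Matrix (Fin (n + 1)) (Fin (n + 1)) ℂ} (hγ : γᴴ * ballGram n * γ = ballGram n)
    (hdet : γ.det = 1) : ∃ g : stdSpecialUnitaryGroup n 1, chartMatrix g = γ := by
  set M : Matrix (Fin n ⊕ Fin 1) (Fin n ⊕ Fin 1) ℂ := γ.submatrix (chartIdx n) (chartIdx n) with hMdef
  have hS : sigMatrix n 1 = -(ballGram n).submatrix (chartIdx n) (chartIdx n) := by
    have h := congrArg (fun M : Matrix (Fin (n + 1)) (Fin (n + 1)) ℂ => M.submatrix (chartIdx n) (chartIdx n))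
      (submatrix_sigMatrix_chartIdx (n := n))
    simp only [Matrix.submatrix_submatrix, Equiv.symm_comp_self, Matrix.submatrix_id_id, Matrix.submatrix_neg] at h
    exact h
  have hM : Mᴴ * sigMatrix n 1 * M = sigMatrix n 1 := by
    rw [hS, hMdef, Matrix.conjTranspose_submatrix, Matrix.mul_neg, Matrix.neg_mul, Matrix.submatrix_mul_equiv,
      Matrix.submatrix_mul_equiv, hγ]
  have hMdet : M.det = 1 := by rw [hMdef, Matrix.det_submatrix_equiv_self]; exact hdet
  refine ⟨⟨ofStdMat M hM, ofStdMat_mem_stdSpecialUnitaryGroup M hM hMdet⟩, ?_⟩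
  rw [chartMatrix, stdMat_ofStdMat, hMdef, Matrix.submatrix_submatrix, Equiv.self_comp_symm, Matrix.submatrix_id_id]

/-- `|det γ| = 1` for every `γ` with `γᴴ J γ = J`. [cite: AllcockFreitag2002, (2.1)] -/
theorem norm_det_eq_one_of_conjTranspose_mul_ballGram_mul {γ : Matrix (Fin (n + 1)) (Fin (n + 1)) ℂ}
    (hγ : γᴴ * ballGram n * γ = ballGram n) : ‖γ.det‖ = 1 := by
  have hJ : (ballGram n).det ≠ 0 := by
    have h1 := congrArg Matrix.det (ballGram_mul_ballGram (n := n))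
    rw [Matrix.det_mul, Matrix.det_one] at h1
    exact left_ne_zero_of_mul_eq_one h1
  have h := congrArg Matrix.det hγ
  rw [Matrix.det_mul, Matrix.det_mul, Matrix.det_conjTranspose, mul_comm (star γ.det), mul_assoc] at h
  have h2 : star γ.det * γ.det = 1 := mul_left_cancel₀ hJ (h.trans (mul_one _).symm)
  rw [Complex.star_def, ← Complex.normSq_eq_conj_mul_self] at h2
  have h3 : ‖γ.det‖ ^ 2 = 1 := by rw [← Complex.normSq_eq_norm_sq]; exact_mod_cast h2
  nlinarith [norm_nonneg γ.det]

/-- **`U(J) = 𝕊¹ · SU(n, 1)`**: every `γ` with `γᴴ J γ = J` is a unit scalar multiple of the chart matrix of some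
`g ∈ SU(n, 1)` (an `(n+1)`-st root of `det γ`); scalars act trivially on the chart, so the Möbius deck
transformations of the route are those of `SU(n, 1)`. [cite: AllcockFreitag2002, (2.1), (3.1)] [cite: Serre2010, §10.3] -/
theorem exists_smul_chartMatrix_eq {γ : Matrix (Fin (n + 1)) (Fin (n + 1)) ℂ}
    (hγ : γᴴ * ballGram n * γ = ballGram n) :
    ∃ g : stdSpecialUnitaryGroup n 1, ∃ c : ℂ, ‖c‖ = 1 ∧ c • chartMatrix g = γ := by
  obtain ⟨c, hc⟩ := IsAlgClosed.exists_pow_nat_eq γ.det (Nat.succ_pos n)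
  have hcn : ‖c‖ = 1 := by
    have h1 : ‖c‖ ^ (n + 1) = 1 := by
      rw [← norm_pow, hc, norm_det_eq_one_of_conjTranspose_mul_ballGram_mul hγ]
    exact (pow_eq_one_iff_of_nonneg (norm_nonneg c) (Nat.succ_ne_zero n)).1 h1
  have hc0 : c ≠ 0 := fun h => by rw [h, norm_zero] at hcn; exact zero_ne_one hcn
  have hcc : star c * c = 1 := by
    rw [Complex.star_def, ← Complex.normSq_eq_conj_mul_self, Complex.normSq_eq_norm_sq, hcn, one_pow,
      Complex.ofReal_one]
  set γ' : Matrix (Fin (n + 1)) (Fin (n + 1)) ℂ := c⁻¹ • γ with hγ'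
  have hγ'J : γ'ᴴ * ballGram n * γ' = ballGram n := by
    rw [hγ', Matrix.conjTranspose_smul, Matrix.smul_mul, Matrix.smul_mul, Matrix.mul_smul, hγ, smul_smul,
      star_inv₀, ← mul_inv, hcc, inv_one, one_smul]
  have hγ'det : γ'.det = 1 := by
    rw [hγ', Matrix.det_smul, Fintype.card_fin, ← hc, inv_pow, inv_mul_cancel₀ (pow_ne_zero _ hc0)]
  obtain ⟨g, hg⟩ := exists_chartMatrix_eq hγ'J hγ'det
  refine ⟨g, c, hcn, ?_⟩
  rw [hg, hγ', smul_smul, mul_inv_cancel₀ hc0, one_smul]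

/-! ### The chart point of `Z ∈ I_{n,1}` and the Möbius deck relation -/

/-- The chart's homogeneous coordinates `ẑ = (1, z₁, …, zₙ)` of `z = Z† e` are the lane's vector `(z, e) ∈ ℂⁿ × ℂ¹`
reindexed by `chartIdx`. [cite: AllcockFreitag2002, (3.1)] -/
theorem ballLift_eq_sumElim_comp (z : EuclideanSpace ℂ (Fin n)) :
    ballLift z = Sum.elim (⇑z) (⇑unitVec) ∘ (chartIdx n).symm := by
  funext i
  refine Fin.cases ?_ (fun j => ?_) i
  · rw [ballLift_zero, Function.comp_apply, chartIdx_symm_zero, Sum.elim_inr, unitVec_zero]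
  · rw [ballLift_succ, Function.comp_apply, chartIdx_symm_succ, Sum.elim_inl]

/-- The standard-basis matrix of `A` acts on coordinate vectors as `A` acts on `ℂⁿ × ℂ¹`:
`stdMat A · (v, w) = A(v, w)` in coordinates. [cite: Serre2010, §10.4 ("let us write `M` blockwise")] -/
theorem stdMat_mulVec_sumElim {p q : ℕ}
    (A : (EuclideanSpace ℂ (Fin p) × EuclideanSpace ℂ (Fin q)) ≃ₗ[ℂ]
      (EuclideanSpace ℂ (Fin p) × EuclideanSpace ℂ (Fin q)))
    (v : EuclideanSpace ℂ (Fin p)) (w : EuclideanSpace ℂ (Fin q)) :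
    stdMat A *ᵥ Sum.elim (⇑v) (⇑w) = Sum.elim (⇑(A (v, w)).1) (⇑(A (v, w)).2) := by
  have hrepr : ∀ x : EuclideanSpace ℂ (Fin p) × EuclideanSpace ℂ (Fin q),
      (⇑((AdaptedBasis.std p q).basis.repr x) : Fin p ⊕ Fin q → ℂ) = Sum.elim (⇑x.1) (⇑x.2) := by
    intro x
    funext s
    rcases s with i | j
    · rw [AdaptedBasis.std, Module.Basis.prod_repr_inl, OrthonormalBasis.coe_toBasis_repr_apply,
        EuclideanSpace.basisFun_repr, Sum.elim_inl]
    · rw [AdaptedBasis.std, Module.Basis.prod_repr_inr, OrthonormalBasis.coe_toBasis_repr_apply,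
        EuclideanSpace.basisFun_repr, Sum.elim_inr]
  rw [← hrepr (v, w), ← hrepr (A (v, w)), stdMat, AdaptedBasis.mat]
  exact LinearMap.toMatrix_mulVec_repr _ _ _ _

/-- The denominator of the Möbius map does not vanish on the ball: `(A₂₁ z + A₂₂ e)₀ ≠ 0` for `z = Z† e`, `Z ∈ I_{n,1}`
(`g (z, e)` is again a NEGATIVE vector). [cite: GohbergLancasterRodman2005, §10.2 (p0234 L30: "`A₁₁ + A₁₂K` is invertible for every `K ∈ S₀`")] -/
theorem cblock₂_ballVector_apply_ne_zero (g : stdSpecialUnitaryGroup n 1) (Z : unitaryPeriodDomain n 1) :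
    (cblock₂₁ (suCLM g) (ballVector (Z : EuclideanSpace ℂ (Fin n) →L[ℂ] EuclideanSpace ℂ (Fin 1))) +
        cblock₂₂ (suCLM g) unitVec) 0 ≠ 0 := by
  obtain ⟨h, rfl⟩ := MulAction.exists_smul_eq (stdSpecialUnitaryGroup n 1) (zeroPoint n 1) Z
  set z := ballVector ((h • zeroPoint n 1 : unitaryPeriodDomain n 1) :
    EuclideanSpace ℂ (Fin n) →L[ℂ] EuclideanSpace ℂ (Fin 1)) with hz
  set c : ℂ := cblock₂₂ (suCLM h) unitVec 0 with hc
  have h12 : cblock₁₂ (suCLM h) unitVec = c • z := cblock₁₂_unitVec_eq_smul_ballVector h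
  have h22 : cblock₂₂ (suCLM h) unitVec = c • unitVec := by
    ext i
    rw [Fin.fin_one_eq_zero i, PiLp.smul_apply, unitVec_zero, smul_eq_mul, mul_one]
  have hmul : suCLM (g * h) (0, unitVec) = suCLM g (cblock₁₂ (suCLM h) unitVec, cblock₂₂ (suCLM h) unitVec) := by
    rw [suCLM_apply, Subgroup.coe_mul, LinearEquiv.mul_apply, ← suCLM_apply h, ← suCLM_apply g,
      apply_eq_cblocks (suCLM h) 0 unitVec, map_zero, map_zero, zero_add, zero_add]
  have hden : cblock₂₂ (suCLM (g * h)) unitVec = c • (cblock₂₁ (suCLM g) z + cblock₂₂ (suCLM g) unitVec) := by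
    rw [cblock₂₂_apply, hmul, h12, h22, apply_eq_cblocks]
    simp only [map_smul, smul_add]
  intro h0
  apply cblock₂₂_unitVec_apply_ne_zero (g * h)
  rw [hden, PiLp.smul_apply, smul_eq_mul, h0, mul_zero]

/-- **The Möbius deck relation, vector form**: `γ ẑ = (γ ẑ)₀ • ŵ` for `γ = chartMatrix g`, `z` the chart point of
`Z ∈ I_{n,1}` and `w` the chart point of `g • Z` — the lane's action of `SU(n, 1)` on `I_{n,1}`, read in the chart
`z₀ = 1` through `ballHomeomorph`, IS the projective action on `ẑ`. [cite: AllcockFreitag2002, (3.1)]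
[cite: CarlsonMullerStachPeters2017, §17.3 (p0413 L26: the ball as `h(z) < 0` in projective space)] -/
theorem chartMatrix_mulVec_ballLift (g : stdSpecialUnitaryGroup n 1) (Z : unitaryPeriodDomain n 1) :
    chartMatrix g *ᵥ ballLift (ballHomeomorph Z : EuclideanSpace ℂ (Fin n)) =
      (chartMatrix g *ᵥ ballLift (ballHomeomorph Z : EuclideanSpace ℂ (Fin n))) 0 •
        ballLift (ballHomeomorph (g • Z) : EuclideanSpace ℂ (Fin n)) := by
  set z := ballVector (Z : EuclideanSpace ℂ (Fin n) →L[ℂ] EuclideanSpace ℂ (Fin 1)) with hz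
  set d : ℂ := (cblock₂₁ (suCLM g) z + cblock₂₂ (suCLM g) unitVec) 0 with hd
  have hd0 : d ≠ 0 := cblock₂_ballVector_apply_ne_zero g Z
  have hlift : chartMatrix g *ᵥ ballLift (ballHomeomorph Z : EuclideanSpace ℂ (Fin n)) =
      Sum.elim (⇑(cblock₁₁ (suCLM g) z + cblock₁₂ (suCLM g) unitVec))
        (⇑(cblock₂₁ (suCLM g) z + cblock₂₂ (suCLM g) unitVec)) ∘ (chartIdx n).symm := by
    rw [coe_ballHomeomorph_apply, ballLift_eq_sumElim_comp, chartMatrix, Matrix.submatrix_mulVec_equiv,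
      Equiv.symm_symm, Function.comp_assoc, Equiv.symm_comp_self, Function.comp_id, stdMat_mulVec_sumElim,
      ← suCLM_apply, apply_eq_cblocks]
  have h0 : (chartMatrix g *ᵥ ballLift (ballHomeomorph Z : EuclideanSpace ℂ (Fin n))) 0 = d := by
    rw [hlift, Function.comp_apply, chartIdx_symm_zero, Sum.elim_inr]
  rw [h0, hlift, coe_ballHomeomorph_apply, ballVector_smul, ballLift_eq_sumElim_comp]
  funext i
  refine Fin.cases ?_ (fun j => ?_) i
  · rw [Function.comp_apply, chartIdx_symm_zero, Sum.elim_inr, Pi.smul_apply, Function.comp_apply,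
      chartIdx_symm_zero, Sum.elim_inr, unitVec_zero, smul_eq_mul, mul_one]
  · rw [Function.comp_apply, chartIdx_symm_succ, Sum.elim_inl, Pi.smul_apply, Function.comp_apply,
      chartIdx_symm_succ, Sum.elim_inl, PiLp.smul_apply, smul_smul, ← hz, ← hd, mul_inv_cancel₀ hd0, one_smul]

/-- **The route's deck clause holds for `(z, w) = (chart Z, chart (g • Z))` and `γ = c • chartMatrix g`** — verbatim
the coordinate relation `wᵢ (γ₀₀ + Σⱼ γ₀,ⱼ₊₁ zⱼ) = γᵢ₊₁,₀ + Σⱼ γᵢ₊₁,ⱼ₊₁ zⱼ` of the items of route `EisensteinMiddleThird`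
(through `smul_ballLift_eq_mulVec_iff`). [cite: AllcockFreitag2002, (3.1)] -/
theorem deckClause_chart_smul (g : stdSpecialUnitaryGroup n 1) (c : ℂ) (Z : unitaryPeriodDomain n 1) (i : Fin n) :
    EuclideanSpace.equiv (Fin n) ℂ (ballHomeomorph (g • Z) : EuclideanSpace ℂ (Fin n)) i *
        ((c • chartMatrix g) 0 0 + ∑ j : Fin n, (c • chartMatrix g) 0 j.succ *
          EuclideanSpace.equiv (Fin n) ℂ (ballHomeomorph Z : EuclideanSpace ℂ (Fin n)) j) =
      (c • chartMatrix g) i.succ 0 + ∑ j : Fin n, (c • chartMatrix g) i.succ j.succ *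
        EuclideanSpace.equiv (Fin n) ℂ (ballHomeomorph Z : EuclideanSpace ℂ (Fin n)) j := by
  revert i
  rw [← smul_ballLift_eq_mulVec_iff, Matrix.smul_mulVec, Pi.smul_apply, smul_eq_mul, mul_smul,
    ← chartMatrix_mulVec_ballLift]

/-- **Conversely, the deck clause determines `w`**: if `w` satisfies the route's clause against `z = chart Z` and
`γ = c • chartMatrix g` with `c ≠ 0`, then `w = chart (g • Z)`. [cite: AllcockFreitag2002, (3.1)] -/
theorem eq_chart_smul_of_deckClause (g : stdSpecialUnitaryGroup n 1) {c : ℂ} (hc : c ≠ 0) (Z : unitaryPeriodDomain n 1)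
    {w : EuclideanSpace ℂ (Fin n)}
    (hw : ∀ i : Fin n, EuclideanSpace.equiv (Fin n) ℂ w i *
        ((c • chartMatrix g) 0 0 + ∑ j : Fin n, (c • chartMatrix g) 0 j.succ *
          EuclideanSpace.equiv (Fin n) ℂ (ballHomeomorph Z : EuclideanSpace ℂ (Fin n)) j) =
      (c • chartMatrix g) i.succ 0 + ∑ j : Fin n, (c • chartMatrix g) i.succ j.succ *
        EuclideanSpace.equiv (Fin n) ℂ (ballHomeomorph Z : EuclideanSpace ℂ (Fin n)) j) :
    w = (ballHomeomorph (g • Z) : EuclideanSpace ℂ (Fin n)) := by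
  rw [← smul_ballLift_eq_mulVec_iff, Matrix.smul_mulVec, Pi.smul_apply, smul_eq_mul] at hw
  have key := chartMatrix_mulVec_ballLift g Z
  set v := chartMatrix g *ᵥ ballLift (ballHomeomorph Z : EuclideanSpace ℂ (Fin n)) with hv
  have hd0 : v 0 ≠ 0 := by
    intro h0
    have hzero : v = 0 := by rw [key, h0, zero_smul]
    have hdet : IsUnit (chartMatrix g) :=
      (Matrix.isUnit_iff_isUnit_det _).2 (by rw [det_chartMatrix]; exact isUnit_one)
    exact ballLift_ne_zero _
      (Matrix.mulVec_injective_iff_isUnit.2 hdet (hzero.trans (Matrix.mulVec_zero (chartMatrix g)).symm))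
  have hw' : (c * v 0) • ballLift w = (c * v 0) • ballLift (ballHomeomorph (g • Z) : EuclideanSpace ℂ (Fin n)) := by
    calc (c * v 0) • ballLift w = c • v := hw
      _ = c • (v 0 • ballLift (ballHomeomorph (g • Z) : EuclideanSpace ℂ (Fin n))) := congrArg (c • ·) key
      _ = (c * v 0) • ballLift (ballHomeomorph (g • Z) : EuclideanSpace ℂ (Fin n)) := smul_smul _ _ _
  have hlift : ballLift w = ballLift (ballHomeomorph (g • Z) : EuclideanSpace ℂ (Fin n)) :=
    smul_right_injective (Fin (n + 1) → ℂ) (mul_ne_zero hc hd0) hw'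
  exact (EuclideanSpace.equiv (Fin n) ℂ).injective (funext fun j => by
    have hj := congr_fun hlift j.succ
    rwa [ballLift_succ, ballLift_succ] at hj)

/-- **The route's deck relation is the orbit relation of `SU(n, 1)` on `I_{n,1}`.** For a set `S` of matrices with
`γᴴ J γ = J` (the route's deck generators) and chart points `z, w` of the ball: "`∃ γ ∈ S`, `w = γ · z` (the
coordinate clause)" holds iff some `g ∈ SU(n, 1)` whose chart matrix lies in `S` up to a unit scalar moves
`ballHomeomorph⁻¹ z` to `ballHomeomorph⁻¹ w`. This is the dictionary through which the lane's Layer A (the symmetric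
space `I_{n,1}`, its invariant measure and metric, compact fixed points, torsion-free ⇒ free action, …) applies to
the chart ball of route `EisensteinMiddleThird`. [cite: AllcockFreitag2002, (2.1), (3.1)]
[cite: BergeronMillsonMoeglin2016Balls, Introduction §1.1 (p0003 L26)] -/
theorem exists_deckClause_iff_exists_smul {S : Set (Matrix (Fin (n + 1)) (Fin (n + 1)) ℂ)}
    (hS : ∀ γ ∈ S, γᴴ * ballGram n * γ = ballGram n) (z w : Metric.ball (0 : EuclideanSpace ℂ (Fin n)) 1) :
    (∃ γ ∈ S, ∀ i : Fin n, EuclideanSpace.equiv (Fin n) ℂ (w : EuclideanSpace ℂ (Fin n)) i *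
        (γ 0 0 + ∑ j : Fin n, γ 0 j.succ * EuclideanSpace.equiv (Fin n) ℂ (z : EuclideanSpace ℂ (Fin n)) j) =
      γ i.succ 0 + ∑ j : Fin n, γ i.succ j.succ * EuclideanSpace.equiv (Fin n) ℂ (z : EuclideanSpace ℂ (Fin n)) j) ↔
    ∃ g : stdSpecialUnitaryGroup n 1, (∃ c : ℂ, ‖c‖ = 1 ∧ c • chartMatrix g ∈ S) ∧
      g • ballHomeomorph.symm z = ballHomeomorph.symm w := by
  have hz : (z : EuclideanSpace ℂ (Fin n)) = (ballHomeomorph (ballHomeomorph.symm z) : EuclideanSpace ℂ (Fin n)) := by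
    rw [Homeomorph.apply_symm_apply]
  constructor
  · rintro ⟨γ, hγS, hγ⟩
    obtain ⟨g, c, hc1, hcg⟩ := exists_smul_chartMatrix_eq (hS γ hγS)
    have hc0 : c ≠ 0 := fun h => by rw [h, norm_zero] at hc1; exact zero_ne_one hc1
    rw [← hcg, hz] at hγ
    have hw := eq_chart_smul_of_deckClause g hc0 (ballHomeomorph.symm z) hγ
    refine ⟨g, ⟨c, hc1, hcg ▸ hγS⟩, ?_⟩
    apply ballHomeomorph.injective
    rw [Homeomorph.apply_symm_apply]
    exact Subtype.ext hw.symm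
  · rintro ⟨g, ⟨c, -, hcS⟩, hg⟩
    refine ⟨c • chartMatrix g, hcS, ?_⟩
    have hw : (w : EuclideanSpace ℂ (Fin n)) =
        (ballHomeomorph (g • ballHomeomorph.symm z) : EuclideanSpace ℂ (Fin n)) := by
      rw [hg, Homeomorph.apply_symm_apply]
    rw [hz, hw]
    exact deckClause_chart_smul g c (ballHomeomorph.symm z)

/-- In particular (`S = {γ}`): **`w = γ · z` in the chart iff `ballHomeomorph⁻¹ w = g • ballHomeomorph⁻¹ z`** for the
(unique up to the centre) `g ∈ SU(n, 1)` under `γ = c • chartMatrix g`. [cite: AllcockFreitag2002, (3.1)] -/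
theorem deckClause_iff_smul_eq (g : stdSpecialUnitaryGroup n 1) {c : ℂ} (hc : c ≠ 0)
    (z w : Metric.ball (0 : EuclideanSpace ℂ (Fin n)) 1) :
    (∀ i : Fin n, EuclideanSpace.equiv (Fin n) ℂ (w : EuclideanSpace ℂ (Fin n)) i *
        ((c • chartMatrix g) 0 0 + ∑ j : Fin n, (c • chartMatrix g) 0 j.succ *
          EuclideanSpace.equiv (Fin n) ℂ (z : EuclideanSpace ℂ (Fin n)) j) =
      (c • chartMatrix g) i.succ 0 + ∑ j : Fin n, (c • chartMatrix g) i.succ j.succ *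
        EuclideanSpace.equiv (Fin n) ℂ (z : EuclideanSpace ℂ (Fin n)) j) ↔
    g • ballHomeomorph.symm z = ballHomeomorph.symm w := by
  have hz : (z : EuclideanSpace ℂ (Fin n)) = (ballHomeomorph (ballHomeomorph.symm z) : EuclideanSpace ℂ (Fin n)) := by
    rw [Homeomorph.apply_symm_apply]
  constructor
  · intro h
    rw [hz] at h
    have hw := eq_chart_smul_of_deckClause g hc (ballHomeomorph.symm z) h
    apply ballHomeomorph.injective
    rw [Homeomorph.apply_symm_apply]
    exact Subtype.ext hw.symm
  · intro hg
    have hw : (w : EuclideanSpace ℂ (Fin n)) =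
        (ballHomeomorph (g • ballHomeomorph.symm z) : EuclideanSpace ℂ (Fin n)) := by
      rw [hg, Homeomorph.apply_symm_apply]
    rw [hz, hw]
    exact deckClause_chart_smul g c (ballHomeomorph.symm z)

/-! ### The route's literal `n = 4` matrix, and finite-order deck transformations -/

/-- For `n = 4` with the route's literal Gram matrix: `γᴴ · diag(1,-1,-1,-1,-1) · γ = diag(1,-1,-1,-1,-1)` for the chart
matrix `γ` of every `g ∈ SU(4, 1)`. [cite: AllcockFreitag2002, (2.1)] -/
theorem conjTranspose_chartMatrix_mul_diagonal_four (g : stdSpecialUnitaryGroup 4 1) :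
    (chartMatrix g)ᴴ * Matrix.diagonal ![(1 : ℂ), -1, -1, -1, -1] * chartMatrix g =
      Matrix.diagonal ![(1 : ℂ), -1, -1, -1, -1] := by
  rw [← ballGram_four]
  exact conjTranspose_chartMatrix_mul_ballGram_mul g

/-- For `n = 4` with the route's literal Gram matrix: every `γ ∈ M₅(ℂ)` with
`γᴴ · diag(1,-1,-1,-1,-1) · γ = diag(1,-1,-1,-1,-1)` is `c • chartMatrix g`, `|c| = 1`, `g ∈ SU(4, 1)`.
[cite: AllcockFreitag2002, (2.1)] [cite: Serre2010, §10.3] -/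
theorem exists_smul_chartMatrix_eq_of_diagonal_four {γ : Matrix (Fin 5) (Fin 5) ℂ}
    (hγ : γᴴ * Matrix.diagonal ![(1 : ℂ), -1, -1, -1, -1] * γ = Matrix.diagonal ![(1 : ℂ), -1, -1, -1, -1]) :
    ∃ g : stdSpecialUnitaryGroup 4 1, ∃ c : ℂ, ‖c‖ = 1 ∧ c • chartMatrix g = γ := by
  rw [← ballGram_four] at hγ
  exact exists_smul_chartMatrix_eq hγ

/-- **A deck transformation of finite order fixes a point of the chart ball** (É. Cartan's fixed-point theorem for the
finite group `⟨g⟩`, `Motives/UnitaryPeriodDomainCompactFixedPoint`, read in the chart): for `g ∈ SU(n, 1)` of finite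
order and any scalar `c`, some `z ∈ 𝔹ⁿ` satisfies the route's clause `z = (c • chartMatrix g) · z`. Contrapositive: a
deck group acting without fixed points on `𝔹ⁿ` is torsion-free.
[cite: FarmakisMoskowitz2013, Thm. 4.0.1 (p0086 L13–L15)] [cite: AllcockFreitag2002, (3.1)] -/
theorem exists_deckClause_self_of_isOfFinOrder (g : stdSpecialUnitaryGroup n 1) (hg : IsOfFinOrder g) (c : ℂ) :
    ∃ z ∈ Metric.ball (0 : EuclideanSpace ℂ (Fin n)) 1, ∀ i : Fin n,
      EuclideanSpace.equiv (Fin n) ℂ z i *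
          ((c • chartMatrix g) 0 0 + ∑ j : Fin n, (c • chartMatrix g) 0 j.succ * EuclideanSpace.equiv (Fin n) ℂ z j) =
        (c • chartMatrix g) i.succ 0 + ∑ j : Fin n, (c • chartMatrix g) i.succ j.succ * EuclideanSpace.equiv (Fin n) ℂ z j := by
  obtain ⟨Z, hZ⟩ := exists_smul_eq_of_isOfFinOrder g hg
  refine ⟨(ballHomeomorph Z : EuclideanSpace ℂ (Fin n)), (ballHomeomorph Z).2, ?_⟩
  have h := deckClause_chart_smul g c Z
  rw [hZ] at h
  exact h

/-- **Free ⇒ torsion-free for deck transformations**: if `g ≠ 1` and `c • chartMatrix g` (`c` any scalar) fixes no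
point of the chart ball, then `g` has infinite order. [cite: FarmakisMoskowitz2013, Thm. 4.0.1, Cor. 4.2.11]
[cite: AllcockFreitag2002, (3.1)] -/
theorem not_isOfFinOrder_of_forall_not_deckClause_self (g : stdSpecialUnitaryGroup n 1) (c : ℂ)
    (hfree : ∀ z ∈ Metric.ball (0 : EuclideanSpace ℂ (Fin n)) 1, ¬ ∀ i : Fin n,
      EuclideanSpace.equiv (Fin n) ℂ z i *
          ((c • chartMatrix g) 0 0 + ∑ j : Fin n, (c • chartMatrix g) 0 j.succ * EuclideanSpace.equiv (Fin n) ℂ z j) =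
        (c • chartMatrix g) i.succ 0 + ∑ j : Fin n, (c • chartMatrix g) i.succ j.succ * EuclideanSpace.equiv (Fin n) ℂ z j) :
    ¬ IsOfFinOrder g := fun hg => by
  obtain ⟨z, hz, h⟩ := exists_deckClause_self_of_isOfFinOrder g hg c
  exact hfree z hz h

end Chart

end Literature.AlgebraicGeometry.Motives
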